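import Literature.NumberTheory.LFunctions.Zhang2022.Section8ProfileSjRanges
import HarnessLib

/-!
# Zhang (2022) §8 for profile data, BILINEAR version: the exact form of `S_j(𝐚_u, conj 𝐚_v)` for TWO short pieces,
# the good range `n < P^{θ₀}/T²` and the three slivers `P^{θ₀}/T² ≤ n < P^{θ₀}`, `θ₀ = min(θ_u, θ_v)`

Topic `Literature/NumberTheory/LFunctions/Zhang2022` (Landau–Siegel audit tree; verdict-neutral). Y. Zhang, *Discrete mean
estimates and the Landau–Siegel zero*, arXiv:2211.02515v1 (2022) [Zhang2022LandauSiegel] — **an unrefereed manuscript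
under adjudication; nothing here asserts or denies its Theorems 1–2; no claim about Landau–Siegel zeros.** Cell
landau-siegel §D, crux K0 = stmt-Parity-20459 `InClassSideTablesPiece` (line «sjrows»), prover ls-knife-K0-p1 g3.
Bilinear twin of `Section8ProfileSjExact` + `Section8ProfileSjRanges` (ψ-side piece `u` of length `θ_u`, anti-side piece
`v` of length `θ_v`; the pointwise rows `psi_main_bound` / `anti_main_bound` and the crude bounds are per side and apply
verbatim). What is new is the bookkeeping of TWO lengths:

* `antiSum_eq_zero_of_le` — `N_j(d,r)[v] = 0` for `dr ≥ P^{θ_v}`; `Sj_pair_eq_split` — for quadratic `χ`,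
  `S_j(𝐚_u, conj 𝐚_v) = Σ_{n<K}Σ_{dr=n} w_j(d,r)M_j(n)[u]N_j(d,r)[v]` for any cut `K ≥ P^{θ₀}` beyond which `u` OR `v` vanishes,
  split at `Y`;
* `good_range_pair_bound` — on `n < Y = e^{(θ₀−τ₁)Λ}` (`θ₀ ≤ θ_u, θ_v`) both rows apply:
  `‖ΣΣ w(MN − AB)‖ ≤ 2e⁴³⁰Λ⁻²·ERR·(1 + log Y)` with `ERR = errGood … θ_v`;
* `sliver_range_bound_of` — the sliver sum from a pointwise bound `‖M_j(n)[u]N_j(d,r)[v]‖ ≤ E·R(d,r)`;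
* the three pointwise sliver bounds: `sliver_term_pair_crude` (`θ_u = θ_v`: both inner sums crude-small, as in the
  diagonal case), `sliver_term_pair_psiCrude` (`θ_u < θ_v`: `M_j[u]` crude-small × `N_j[v]` of main-term size — `v` is in
  ITS good range there), `sliver_term_pair_antiCrude` (`θ_v < θ_u`: `M_j[u]` of main-term size × `N_j[v]` crude-small).

## References
* Y. Zhang, arXiv:2211.02515v1 (2022), §7 Prop 7.1 (7.2); §8 Lemmas 8.2–8.4, display before (8.10), p.47.
  [cite: Zhang2022LandauSiegel, §8 p.47]
-/

noncomputable section

open Complex Real MeasureTheory Set intervalIntegral Filter Finset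
open scoped ComplexConjugate Topology

namespace Literature.NumberTheory.LFunctions.Zhang2022.DipoleRule

open Skeleton KnifeEdge

/-! ### The anti-side inner sum vanishes beyond `P^{θ_v}` -/

/-- `log P = 𝓛⁹`. [cite: Zhang2022LandauSiegel, §2 (2.6)] -/
private theorem log_bigP'' (D : ℕ) : Real.log (bigP D) = Real.log D ^ 9 := by rw [bigP, Real.log_exp]; rfl

/-- **`N_j(d,r)[v] = 0` for `dr ≥ e^{θ_v𝓛⁹} = P^{θ_v}`** (`v = 0` on `[θ_v,∞)`; every `drn ≥ dr` has `z_{drn} ≥ θ_v`).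
[cite: Zhang2022LandauSiegel, §7 Prop 7.1 (7.2)] -/
theorem antiSum_eq_zero_of_le {c' : ℝ} {D : ℕ} (χ : DirichletCharacter ℂ D) (j : ℕ) {v : ℝ → ℂ} {θ : ℝ}
    (hvan : ∀ y : ℝ, θ ≤ y → v y = 0) (hℓ : 0 < Real.log D) {d r : ℕ}
    (ht : Real.exp (θ * Real.log D ^ 9) ≤ ((d * r : ℕ) : ℝ)) : antiSum c' D χ j v d r = 0 := by
  unfold antiSum
  refine Finset.sum_eq_zero fun n hn => ?_
  rw [Finset.mem_Ico] at hn
  have hΛ : 0 < Real.log D ^ 9 := by positivity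
  have htn : Real.exp (θ * Real.log D ^ 9) ≤ ((d * r * n : ℕ) : ℝ) := by
    have h1 : ((d * r : ℕ) : ℝ) ≤ ((d * r * n : ℕ) : ℝ) := by exact_mod_cast Nat.le_mul_of_pos_right _ hn.1
    exact ht.trans h1
  have hz : θ ≤ Real.log ((d * r * n : ℕ) : ℝ) / Real.log (bigP D) := by
    rw [log_bigP'', le_div_iff₀ hΛ, ← Real.log_exp (θ * Real.log D ^ 9)]
    exact Real.log_le_log (Real.exp_pos _) htn
  unfold profTable
  split_ifs with hg
  · rw [hvan _ hz, mul_zero, map_zero, zero_mul, zero_div]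
  · rw [map_zero, zero_mul, zero_div]

/-! ### The exact identity for two pieces -/

/-- The `(d,r)`-term of `S_j(𝐚_u, conj 𝐚_v)` is `w_j(d,r)·(M_j(dr)[u]·N_j(d,r)[v])` (quadratic `χ`).
[cite: Zhang2022LandauSiegel, §7 Prop 7.1; §8 p.47] -/
theorem sj_pair_term_eq {c' : ℝ} {D : ℕ} {χ : DirichletCharacter ℂ D} (hq : χ.IsQuadratic) (j : ℕ)
    (u v : ℝ → ℂ) (d r : ℕ) :
    ((ArithmeticFunction.moebius r).natAbs : ℂ) * lamZero c' D j (d * r) / ((d * r : ℕ) * (Nat.totient r : ℂ)) *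
        (∑ m ∈ Finset.Ico 1 (Nsupp D), profTable u D χ (d * r * m) / (m : ℂ) ^ (1 - betaJ c' D j)) *
        (∑ n ∈ Finset.Ico 1 (Nsupp D),
          (fun k => conj (profTable v D χ k)) (d * r * n) * xiZero c' D j n d r / (n : ℂ))
      = sjWeight c' χ j (d, r) * (psiSum c' D χ j u (d * r) * antiSum c' D χ j v d r) := by
  have hM : (∑ m ∈ Finset.Ico 1 (Nsupp D), profTable u D χ (d * r * m) / (m : ℂ) ^ (1 - betaJ c' D j))
      = psiSum c' D χ j u (d * r) := rfl
  have hN : (∑ n ∈ Finset.Ico 1 (Nsupp D),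
      (fun k => conj (profTable v D χ k)) (d * r * n) * xiZero c' D j n d r / (n : ℂ)) = antiSum c' D χ j v d r := rfl
  rw [hM, hN]
  nth_rewrite 1 [psiSum_eq_norm_mul hq j u (d * r)]
  unfold sjWeight
  simp only [Nat.cast_mul]
  ring

/-- **THE EXACT FORM OF `S_j(𝐚_u, conj 𝐚_v)` FOR TWO SHORT PIECES:** for a quadratic `χ`, `𝓛 > 0`, a height `θ₀` from which
`u` OR `v` vanishes on, and any cut `K` with `e^{θ₀𝓛⁹} ≤ K ≤ ⌈PT⁻²⌉`:
`S_j(𝐚_u, conj 𝐚_v) = Σ_{1≤n<K} Σ_{dr=n} w_j(d,r)·(M_j(n)[u]·N_j(d,r)[v])`. [cite: Zhang2022LandauSiegel, §7 Prop 7.1; §8 p.47] -/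
theorem Sj_pair_eq (c' : ℝ) {D : ℕ} {χ : DirichletCharacter ℂ D} (hq : χ.IsQuadratic) (j : ℕ)
    {u v : ℝ → ℂ} {θ₀ : ℝ} (hvan : (∀ y : ℝ, θ₀ ≤ y → u y = 0) ∨ (∀ y : ℝ, θ₀ ≤ y → v y = 0))
    (hℓ : 0 < Real.log D) {K : ℕ} (hK : Real.exp (θ₀ * Real.log D ^ 9) ≤ K) (hKN : K ≤ Nsupp D) :
    Sj c' D j (profTable u D χ) (fun n => conj (profTable v D χ n))
      = ∑ n ∈ Finset.Ico 1 K, ∑ p ∈ Nat.divisorsAntidiagonal n,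
          sjWeight c' χ j p * (psiSum c' D χ j u n * antiSum c' D χ j v p.1 p.2) := by
  unfold Sj
  rw [Finset.sum_congr rfl fun d _ => Finset.sum_congr rfl fun r _ => sj_pair_term_eq hq j u v d r]
  rw [sum_sum_eq_sum_antidiagonal_of_vanish hKN
    (fun d r => sjWeight c' χ j (d, r) * (psiSum c' D χ j u (d * r) * antiSum c' D χ j v d r))]
  · refine Finset.sum_congr rfl fun n _ => Finset.sum_congr rfl fun p hp => ?_
    rw [Nat.mem_divisorsAntidiagonal] at hp
    rw [← hp.1]
  · intro d r _ _ hdr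
    have ht : Real.exp (θ₀ * Real.log D ^ 9) ≤ ((d * r : ℕ) : ℝ) := hK.trans (by exact_mod_cast hdr)
    rcases hvan with hu | hv
    · rw [psiSum_eq_zero_of_le χ j hu hℓ ht, zero_mul, mul_zero]
    · rw [antiSum_eq_zero_of_le χ j hv hℓ ht, mul_zero, mul_zero]

/-- The same identity with the `n`-range split at an intermediate cut `Y` (`1 ≤ Y ≤ K`).
[cite: Zhang2022LandauSiegel, §8 display before (8.10) p.47] -/
theorem Sj_pair_eq_split (c' : ℝ) {D : ℕ} {χ : DirichletCharacter ℂ D} (hq : χ.IsQuadratic) (j : ℕ)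
    {u v : ℝ → ℂ} {θ₀ : ℝ} (hvan : (∀ y : ℝ, θ₀ ≤ y → u y = 0) ∨ (∀ y : ℝ, θ₀ ≤ y → v y = 0))
    (hℓ : 0 < Real.log D) {Y K : ℕ} (hY : 1 ≤ Y) (hYK : Y ≤ K) (hK : Real.exp (θ₀ * Real.log D ^ 9) ≤ K)
    (hKN : K ≤ Nsupp D) :
    Sj c' D j (profTable u D χ) (fun n => conj (profTable v D χ n))
      = (∑ n ∈ Finset.Ico 1 Y, ∑ p ∈ Nat.divisorsAntidiagonal n,
          sjWeight c' χ j p * (psiSum c' D χ j u n * antiSum c' D χ j v p.1 p.2))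
        + ∑ n ∈ Finset.Ico Y K, ∑ p ∈ Nat.divisorsAntidiagonal n,
          sjWeight c' χ j p * (psiSum c' D χ j u n * antiSum c' D χ j v p.1 p.2) := by
  rw [Sj_pair_eq c' hq j hvan hℓ hK hKN, Finset.sum_Ico_consecutive _ hY hYK]

/-! ### The good range `n < P^{θ₀}/T²` -/

/-- **Good term, bilinear:** at `dr = n ≤ e^{(θ₀−τ₁)Λ}` with `θ₀ ≤ θ_u, θ_v` both rows apply (`τ₁ ≤ Z_n` on either side) and
`pointwise_good` gives `‖M_j(n)[u]N_j(d,r)[v] − A_j(n)[u]B_j(d,r)[v]‖ ≤ Λ⁻²·R(d,r)·ERR`, `ERR = errGood … θ_v` at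
`L′ = ‖L′(1,χ)‖`. [cite: Zhang2022LandauSiegel, §8 Lemmas 8.2–8.4 and display before (8.10), p.47] -/
theorem good_term_pair_le {D : ℕ} [NeZero D] (χ : DirichletCharacter ℂ D) (hq : χ.IsQuadratic)
    (hprim : χ.IsPrimitive) (c' : ℝ) (j : ℕ) (hL : 3 ≤ Real.log D) (hA : ‖χ.LFunction 1‖ ≤ 1 / Real.log D ^ 2022)
    {u u' u'' v v' v'' : ℝ → ℂ} {θu θv θ₀ : ℝ} (hθ0 : 0 ≤ θ₀) (h0u : θ₀ ≤ θu) (h0v : θ₀ ≤ θv)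
    (hθu1 : θu ≤ 1) (hθv1 : θv < 1)
    (hu : ContinuousOn u (Icc 0 θu)) (hu' : ContinuousOn u' (Icc 0 θu)) (hu'' : ContinuousOn u'' (Icc 0 θu))
    (hdu : ∀ y ∈ Ioo 0 θu, HasDerivWithinAt u (u' y) (Ioi y) y)
    (hdu' : ∀ y ∈ Ioo 0 θu, HasDerivWithinAt u' (u'' y) (Ioi y) y) (huvan : ∀ y : ℝ, θu ≤ y → u y = 0)
    (hv : ContinuousOn v (Icc 0 θv)) (hv' : ContinuousOn v' (Icc 0 θv)) (hv'' : ContinuousOn v'' (Icc 0 θv))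
    (hdv : ∀ y ∈ Ioo 0 θv, HasDerivWithinAt v (v' y) (Ioi y) y)
    (hdv' : ∀ y ∈ Ioo 0 θv, HasDerivWithinAt v' (v'' y) (Ioi y) y) (hvvan : ∀ y : ℝ, θv ≤ y → v y = 0)
    {B₀ B₁ B₂ : ℝ} (hB00 : 0 ≤ B₀) (hB10 : 0 ≤ B₁) (hB20 : 0 ≤ B₂)
    (hB0u : ∀ y ∈ Icc 0 θu, ‖u y‖ ≤ B₀) (hB1u : ∀ y ∈ Icc 0 θu, ‖u' y‖ ≤ B₁) (hB2u : ∀ y ∈ Icc 0 θu, ‖u'' y‖ ≤ B₂)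
    (hB0v : ∀ y ∈ Icc 0 θv, ‖v y‖ ≤ B₀) (hB1v : ∀ y ∈ Icc 0 θv, ‖v' y‖ ≤ B₁) (hB2v : ∀ y ∈ Icc 0 θv, ‖v'' y‖ ≤ B₂)
    (hθuN : Real.exp (θu * Real.log D ^ 9) < Nsupp D) (hθvN : Real.exp (θv * Real.log D ^ 9) < Nsupp D)
    {d r : ℕ} (hd1 : 1 ≤ d) (hr1 : 1 ≤ r)
    (hnY : ((d * r : ℕ) : ℝ) ≤ Real.exp ((θ₀ - 2 * Real.log D ^ (11 / 10 : ℝ) / Real.log D ^ 9) * Real.log D ^ 9))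
    {C₈₄ Ξ : ℝ}
    (h84 : ∀ y : ℝ, bigT D < y → y < bigP D →
      ‖(∑ n ∈ Finset.Ico 1 ⌈y⌉₊, χ (n : ZMod D) * xiZero c' D j n d r / (n : ℂ) *
            ((y / n : ℝ) : ℂ) ^ (-betaMu D 6) * (Real.log (y / n) : ℂ)) -
          deriv χ.LFunction 1 * PiW χ d r * frakgW c' D j 6 y‖
        ≤ C₈₄ * (Real.log D ^ 6)⁻¹ * (∏ q ∈ (d * r).primeFactors, (1 - (q : ℝ)⁻¹)⁻¹) ^ 2)
    (hΞ : ∀ y : ℝ, 1 ≤ y → y ≤ Real.exp (2 * Real.log D ^ (11 / 10 : ℝ) / Real.log D ^ 9 * Real.log D ^ 9) →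
      ∑ n ∈ Finset.Ico 1 ⌈y⌉₊, ‖xiZero c' D j n d r‖ / n ≤ Ξ) :
    ‖psiSum c' D χ j u (d * r) * antiSum c' D χ j v d r
        - psiMain c' D χ j u u' (d * r) * antiMain c' D χ j v v' θv (d, r)‖
      ≤ ((Real.log D ^ 9) ^ 2)⁻¹ *
          ((∏ q ∈ (d * r).primeFactors, (1 - (q : ℝ)⁻¹)⁻¹) ^ 2 * (1 + ‖PiW χ d r‖)) *
          errGood c' D j B₀ B₁ B₂ C₈₄ Ξ ‖deriv χ.LFunction 1‖ θv := by
  set Λ : ℝ := Real.log D ^ 9 with hΛ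
  set t : ℕ := d * r with htdef
  have hℓ0 : 0 < Real.log D := by linarith
  have hΛ0 : 0 < Λ := by positivity
  have hL1pos : 0 < Real.log D ^ (11 / 10 : ℝ) := Real.rpow_pos_of_pos hℓ0 _
  have ht : 1 ≤ t := Nat.one_le_iff_ne_zero.mpr (Nat.mul_ne_zero (by omega) (by omega))
  have ht0 : (0 : ℝ) < t := by exact_mod_cast ht
  -- `τ₁ ≤ θ₀ − z_t` from `t ≤ e^{(θ₀−τ₁)Λ}`
  have hZτ : 2 * Real.log D ^ (11 / 10 : ℝ) / Λ ≤ θ₀ - Real.log (t : ℝ) / Λ := by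
    have : Real.log (t : ℝ) ≤ (θ₀ - 2 * Real.log D ^ (11 / 10 : ℝ) / Λ) * Λ := by
      rw [← Real.log_exp ((θ₀ - _) * Λ)]; exact Real.log_le_log ht0 hnY
    have : Real.log (t : ℝ) / Λ ≤ θ₀ - 2 * Real.log D ^ (11 / 10 : ℝ) / Λ := by rw [div_le_iff₀ hΛ0]; exact this
    linarith
  have hZτu : Real.log D ^ (11 / 10 : ℝ) / Λ ≤ θu - Real.log (t : ℝ) / Λ := by
    have : Real.log D ^ (11 / 10 : ℝ) / Λ ≤ 2 * Real.log D ^ (11 / 10 : ℝ) / Λ := by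
      rw [div_le_div_iff_of_pos_right hΛ0]; linarith
    linarith [this.trans hZτ]
  have hZτv : 2 * Real.log D ^ (11 / 10 : ℝ) / Λ ≤ θv - Real.log (t : ℝ) / Λ := by linarith [hZτ]
  have hz0 : 0 ≤ Real.log (t : ℝ) / Λ := div_nonneg (Real.log_nonneg (by exact_mod_cast ht)) hΛ0.le
  have hτ0 : 0 ≤ 2 * Real.log D ^ (11 / 10 : ℝ) / Λ := by positivity
  have hzu : Real.log (t : ℝ) / Λ ∈ Icc 0 θu := ⟨hz0, by linarith⟩
  have hzv : Real.log (t : ℝ) / Λ ∈ Icc 0 θv := ⟨hz0, by linarith⟩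
  -- the four inputs of `pointwise_good`
  have hM : ‖psiSum c' D χ j u t - psiMain c' D χ j u u' t‖
      ≤ Λ⁻¹ * deltaM0 c' D j B₀ B₁ B₂ ‖deriv χ.LFunction 1‖ := by
    have h := psi_main_bound χ c' j hprim hL hA hθu1 hu hu' hu'' hdu hdu' huvan hB00 hB10 hB20 hB0u hB1u hB2u ht
      hZτu hθuN
    unfold psiMain
    rw [sub_neg_eq_add]
    exact h
  have hN : ‖antiSum c' D χ j v d r - antiMain c' D χ j v v' θv (d, r)‖
      ≤ Λ⁻¹ * (((∏ q ∈ (d * r).primeFactors, (1 - (q : ℝ)⁻¹)⁻¹) ^ 2 * (1 + ‖PiW χ d r‖)) *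
          deltaN0 c' D j B₀ B₁ B₂ C₈₄ Ξ ‖deriv χ.LFunction 1‖) := by
    have h := anti_main_bound χ hq c' j d r hL hθv1 hv hv' hv'' hdv hdv' hvvan hB00 hB10 hB20 hB0v hB1v hB2v ht
      hZτv hθvN h84 hΞ
    unfold antiMain
    rw [← mul_assoc]
    exact h
  have hAm : ‖psiMain c' D χ j u u' t‖ ≤ Λ⁻¹ * (‖deriv χ.LFunction 1‖ * psiJ0 c' D j B₀ B₁) := by
    unfold psiMain
    rw [norm_neg]
    exact norm_psiMain_le χ c' j hB0u hB1u hzu hℓ0 t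
  have hBm : ‖antiMain c' D χ j v v' θv (d, r)‖
      ≤ Λ⁻¹ * (‖deriv χ.LFunction 1‖ * ‖PiW χ d r‖ * antiK0 c' D j B₀ B₁ θv) := by
    unfold antiMain antiK0
    exact norm_antiMain_le χ d r hB0v hB1v hzv hℓ0 t
  have hC820 : 0 ≤ Lemma82.C82 0 := by
    unfold Lemma82.C82
    have : 0 ≤ Lemma82.I0 := Lemma82.I0_nonneg
    positivity
  have hδM0 : 0 ≤ deltaM0 c' D j B₀ B₁ B₂ ‖deriv χ.LFunction 1‖ := by
    unfold deltaM0; positivity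
  have hK0 : 0 ≤ antiK0 c' D j B₀ B₁ θv := by
    have : 0 ≤ θv := hθ0.trans h0v
    unfold antiK0; positivity
  have hrel1 : 1 ≤ (∏ q ∈ (d * r).primeFactors, (1 - (q : ℝ)⁻¹)⁻¹) ^ 2 :=
    Section8FrontEnd44ReductionRel.one_le_relFac (d * r)
  have hPR : ‖PiW χ d r‖ ≤ (∏ q ∈ (d * r).primeFactors, (1 - (q : ℝ)⁻¹)⁻¹) ^ 2 * (1 + ‖PiW χ d r‖) := by
    have h0 : 0 ≤ ‖PiW χ d r‖ := norm_nonneg _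
    nlinarith
  have key := pointwise_good (M := psiSum c' D χ j u t) (N := antiSum c' D χ j v d r)
    (A := psiMain c' D χ j u u' t) (B := antiMain c' D χ j v v' θv (d, r)) hΛ0 hPR hδM0 (norm_nonneg _) hK0
    hM hN hAm hBm
  unfold errGood
  exact key

/-- **THE GOOD RANGE, bilinear:** with `Y = e^{(θ₀−τ₁)Λ} ≥ 1` and the hypotheses of `good_term_pair_le` for every `(d,r)` with
`dr < Y`: `‖Σ_{n<⌈Y⌉} Σ_{dr=n} w_j(d,r)(M_j(n)[u]N_j(d,r)[v] − A_j(n)[u]B_j(d,r)[v])‖ ≤ 2e⁴³⁰·Λ⁻²·ERR·(1 + log Y)`.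
[cite: Zhang2022LandauSiegel, §8 display before (8.10), p.47] -/
theorem good_range_pair_bound (c' : ℝ) {D : ℕ} [NeZero D] (χ : DirichletCharacter ℂ D) (hq : χ.IsQuadratic)
    (hprim : χ.IsPrimitive) (j : ℕ) (hL : 3 ≤ Real.log D) (hA : ‖χ.LFunction 1‖ ≤ 1 / Real.log D ^ 2022)
    {u u' u'' v v' v'' : ℝ → ℂ} {θu θv θ₀ : ℝ} (hθ0 : 0 ≤ θ₀) (h0u : θ₀ ≤ θu) (h0v : θ₀ ≤ θv)
    (hθu1 : θu ≤ 1) (hθv1 : θv < 1)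
    (hu : ContinuousOn u (Icc 0 θu)) (hu' : ContinuousOn u' (Icc 0 θu)) (hu'' : ContinuousOn u'' (Icc 0 θu))
    (hdu : ∀ y ∈ Ioo 0 θu, HasDerivWithinAt u (u' y) (Ioi y) y)
    (hdu' : ∀ y ∈ Ioo 0 θu, HasDerivWithinAt u' (u'' y) (Ioi y) y) (huvan : ∀ y : ℝ, θu ≤ y → u y = 0)
    (hv : ContinuousOn v (Icc 0 θv)) (hv' : ContinuousOn v' (Icc 0 θv)) (hv'' : ContinuousOn v'' (Icc 0 θv))
    (hdv : ∀ y ∈ Ioo 0 θv, HasDerivWithinAt v (v' y) (Ioi y) y)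
    (hdv' : ∀ y ∈ Ioo 0 θv, HasDerivWithinAt v' (v'' y) (Ioi y) y) (hvvan : ∀ y : ℝ, θv ≤ y → v y = 0)
    {B₀ B₁ B₂ : ℝ} (hB00 : 0 ≤ B₀) (hB10 : 0 ≤ B₁) (hB20 : 0 ≤ B₂)
    (hB0u : ∀ y ∈ Icc 0 θu, ‖u y‖ ≤ B₀) (hB1u : ∀ y ∈ Icc 0 θu, ‖u' y‖ ≤ B₁) (hB2u : ∀ y ∈ Icc 0 θu, ‖u'' y‖ ≤ B₂)
    (hB0v : ∀ y ∈ Icc 0 θv, ‖v y‖ ≤ B₀) (hB1v : ∀ y ∈ Icc 0 θv, ‖v' y‖ ≤ B₁) (hB2v : ∀ y ∈ Icc 0 θv, ‖v'' y‖ ≤ B₂)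
    (hθuN : Real.exp (θu * Real.log D ^ 9) < Nsupp D) (hθvN : Real.exp (θv * Real.log D ^ 9) < Nsupp D)
    (hY1 : 1 ≤ Real.exp ((θ₀ - 2 * Real.log D ^ (11 / 10 : ℝ) / Real.log D ^ 9) * Real.log D ^ 9))
    {C₈₄ Ξ : ℝ} (hC84 : 0 ≤ C₈₄) (hΞ0 : 0 ≤ Ξ)
    (h84 : ∀ d r : ℕ, 1 ≤ d → 1 ≤ r →
      ((d * r : ℕ) : ℝ) < Real.exp ((θ₀ - 2 * Real.log D ^ (11 / 10 : ℝ) / Real.log D ^ 9) * Real.log D ^ 9) →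
      ∀ y : ℝ, bigT D < y → y < bigP D →
        ‖(∑ n ∈ Finset.Ico 1 ⌈y⌉₊, χ (n : ZMod D) * xiZero c' D j n d r / (n : ℂ) *
              ((y / n : ℝ) : ℂ) ^ (-betaMu D 6) * (Real.log (y / n) : ℂ)) -
            deriv χ.LFunction 1 * PiW χ d r * frakgW c' D j 6 y‖
          ≤ C₈₄ * (Real.log D ^ 6)⁻¹ * (∏ q ∈ (d * r).primeFactors, (1 - (q : ℝ)⁻¹)⁻¹) ^ 2)
    (hΞ : ∀ d r : ℕ, 1 ≤ d → 1 ≤ r →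
      ((d * r : ℕ) : ℝ) < Real.exp ((θ₀ - 2 * Real.log D ^ (11 / 10 : ℝ) / Real.log D ^ 9) * Real.log D ^ 9) →
      ∀ y : ℝ, 1 ≤ y → y ≤ Real.exp (2 * Real.log D ^ (11 / 10 : ℝ) / Real.log D ^ 9 * Real.log D ^ 9) →
        ∑ n ∈ Finset.Ico 1 ⌈y⌉₊, ‖xiZero c' D j n d r‖ / n ≤ Ξ) :
    ‖(∑ n ∈ Finset.Ico 1 ⌈Real.exp ((θ₀ - 2 * Real.log D ^ (11 / 10 : ℝ) / Real.log D ^ 9) * Real.log D ^ 9)⌉₊,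
          ∑ p ∈ Nat.divisorsAntidiagonal n, sjWeight c' χ j p * (psiSum c' D χ j u n * antiSum c' D χ j v p.1 p.2))
        - ∑ n ∈ Finset.Ico 1 ⌈Real.exp ((θ₀ - 2 * Real.log D ^ (11 / 10 : ℝ) / Real.log D ^ 9) * Real.log D ^ 9)⌉₊,
          ∑ p ∈ Nat.divisorsAntidiagonal n,
            sjWeight c' χ j p * (psiMain c' D χ j u u' n * antiMain c' D χ j v v' θv p)‖
      ≤ 2 * Real.exp 430 *
          (((Real.log D ^ 9) ^ 2)⁻¹ * errGood c' D j B₀ B₁ B₂ C₈₄ Ξ ‖deriv χ.LFunction 1‖ θv)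
          * (1 + Real.log (Real.exp ((θ₀ - 2 * Real.log D ^ (11 / 10 : ℝ) / Real.log D ^ 9) * Real.log D ^ 9))) := by
  set Y : ℝ := Real.exp ((θ₀ - 2 * Real.log D ^ (11 / 10 : ℝ) / Real.log D ^ 9) * Real.log D ^ 9) with hY
  have hℓ0 : 0 < Real.log D := by linarith
  have hC820 : 0 ≤ Lemma82.C82 0 := by
    unfold Lemma82.C82
    have : 0 ≤ Lemma82.I0 := Lemma82.I0_nonneg
    positivity
  have hL1pos : 0 < Real.log D ^ (11 / 10 : ℝ) := Real.rpow_pos_of_pos hℓ0 _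
  have hθv0 : 0 ≤ θv := hθ0.trans h0v
  have hE : 0 ≤ ((Real.log D ^ 9) ^ 2)⁻¹ * errGood c' D j B₀ B₁ B₂ C₈₄ Ξ ‖deriv χ.LFunction 1‖ θv := by
    unfold errGood deltaM0 deltaN0 antiK0 psiJ0
    positivity
  have key := norm_sum_sum_sjWeight_mul_le c' χ j le_rfl hY1 hE
    (fun p => psiSum c' D χ j u (p.1 * p.2) * antiSum c' D χ j v p.1 p.2
      - psiMain c' D χ j u u' (p.1 * p.2) * antiMain c' D χ j v v' θv p) ?_
  · rw [Nat.ceil_one, div_one] at key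
    have hre : (∑ n ∈ Finset.Ico 1 ⌈Y⌉₊, ∑ p ∈ Nat.divisorsAntidiagonal n,
          sjWeight c' χ j p * (psiSum c' D χ j u n * antiSum c' D χ j v p.1 p.2))
        - ∑ n ∈ Finset.Ico 1 ⌈Y⌉₊, ∑ p ∈ Nat.divisorsAntidiagonal n,
          sjWeight c' χ j p * (psiMain c' D χ j u u' n * antiMain c' D χ j v v' θv p)
        = ∑ n ∈ Finset.Ico 1 ⌈Y⌉₊, ∑ p ∈ Nat.divisorsAntidiagonal n,
          sjWeight c' χ j p * (psiSum c' D χ j u (p.1 * p.2) * antiSum c' D χ j v p.1 p.2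
            - psiMain c' D χ j u u' (p.1 * p.2) * antiMain c' D χ j v v' θv p) := by
      rw [← Finset.sum_sub_distrib]
      refine Finset.sum_congr rfl fun n _ => ?_
      rw [← Finset.sum_sub_distrib]
      refine Finset.sum_congr rfl fun p hp => ?_
      rw [Nat.mem_divisorsAntidiagonal] at hp
      rw [hp.1]; ring
    rw [hre]
    exact key
  · rintro n hn ⟨d, r⟩ hp
    rw [Nat.ceil_one, Finset.mem_Ico] at hn
    rw [Nat.mem_divisorsAntidiagonal] at hp
    obtain ⟨hpn, hn0⟩ := hp
    subst hpn
    have hp1 : 1 ≤ d := Nat.one_le_iff_ne_zero.mpr fun h => hn0 (by rw [h, zero_mul])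
    have hp2 : 1 ≤ r := Nat.one_le_iff_ne_zero.mpr fun h => hn0 (by rw [h, mul_zero])
    have hnY : ((d * r : ℕ) : ℝ) < Y := Nat.lt_ceil.mp hn.2
    have h := good_term_pair_le χ hq hprim c' j hL hA hθ0 h0u h0v hθu1 hθv1 hu hu' hu'' hdu hdu' huvan hv hv' hv''
      hdv hdv' hvvan hB00 hB10 hB20 hB0u hB1u hB2u hB0v hB1v hB2v hθuN hθvN hp1 hp2 hnY.le (h84 d r hp1 hp2 hnY)
      (hΞ d r hp1 hp2 hnY)
    calc _ ≤ _ := h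
      _ = _ := by ring

/-! ### The sliver `P^{θ₀}/T² ≤ n < P^{θ₀}` -/

/-- **THE SLIVER RANGE from a pointwise bound:** if `‖M_j(dr)[u]·N_j(d,r)[v]‖ ≤ E·(∏_{q∣dr}(1−q⁻¹)⁻¹)²(1+|Π(d,r)|)` for all
`d, r ≥ 1` with `Y ≤ dr ≤ X` (`1 ≤ Y ≤ X`, `E ≥ 0`), then `‖Σ_{⌈Y⌉≤n<⌈X⌉} Σ_{dr=n} w_j(d,r)M_jN_j‖ ≤ 2e⁴³⁰·E·(1 + log(X/Y))`.
[cite: Zhang2022LandauSiegel, §8 p.47] -/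
theorem sliver_range_bound_of (c' : ℝ) {D : ℕ} [NeZero D] (χ : DirichletCharacter ℂ D) (j : ℕ) (u v : ℝ → ℂ)
    {Y X E : ℝ} (hY1 : 1 ≤ Y) (hYX : Y ≤ X) (hE : 0 ≤ E)
    (hpt : ∀ d r : ℕ, 1 ≤ d → 1 ≤ r → Y ≤ ((d * r : ℕ) : ℝ) → ((d * r : ℕ) : ℝ) ≤ X →
      ‖psiSum c' D χ j u (d * r) * antiSum c' D χ j v d r‖
        ≤ E * ((∏ q ∈ (d * r).primeFactors, (1 - (q : ℝ)⁻¹)⁻¹) ^ 2 * (1 + ‖PiW χ d r‖))) :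
    ‖∑ n ∈ Finset.Ico ⌈Y⌉₊ ⌈X⌉₊,
        ∑ p ∈ Nat.divisorsAntidiagonal n, sjWeight c' χ j p * (psiSum c' D χ j u n * antiSum c' D χ j v p.1 p.2)‖
      ≤ 2 * Real.exp 430 * E * (1 + Real.log (X / Y)) := by
  have key := norm_sum_sum_sjWeight_mul_le c' χ j hY1 hYX hE
    (fun p => psiSum c' D χ j u (p.1 * p.2) * antiSum c' D χ j v p.1 p.2) ?_
  · have hre : (∑ n ∈ Finset.Ico ⌈Y⌉₊ ⌈X⌉₊, ∑ p ∈ Nat.divisorsAntidiagonal n,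
          sjWeight c' χ j p * (psiSum c' D χ j u n * antiSum c' D χ j v p.1 p.2))
        = ∑ n ∈ Finset.Ico ⌈Y⌉₊ ⌈X⌉₊, ∑ p ∈ Nat.divisorsAntidiagonal n,
          sjWeight c' χ j p * (psiSum c' D χ j u (p.1 * p.2) * antiSum c' D χ j v p.1 p.2) := by
      refine Finset.sum_congr rfl fun n _ => Finset.sum_congr rfl fun p hp => ?_
      rw [Nat.mem_divisorsAntidiagonal] at hp
      rw [hp.1]
    rw [hre]
    exact key
  · rintro n hn ⟨d, r⟩ hp
    rw [Finset.mem_Ico] at hn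
    rw [Nat.mem_divisorsAntidiagonal] at hp
    obtain ⟨hpn, hn0⟩ := hp
    subst hpn
    have hp1 : 1 ≤ d := Nat.one_le_iff_ne_zero.mpr fun h => hn0 (by rw [h, zero_mul])
    have hp2 : 1 ≤ r := Nat.one_le_iff_ne_zero.mpr fun h => hn0 (by rw [h, mul_zero])
    have hnY' : Y ≤ ((d * r : ℕ) : ℝ) := (Nat.le_ceil Y).trans (by exact_mod_cast hn.1)
    have hnX : ((d * r : ℕ) : ℝ) ≤ X := (Nat.lt_ceil.mp hn.2).le
    exact hpt d r hp1 hp2 hnY' hnX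

/-- `0 ≤ Z_t ≤ τ₁` on the sliver `e^{(θ−τ₁)Λ} ≤ t ≤ e^{θΛ}` (`Z_t = θ − log t/Λ`). [cite: Zhang2022LandauSiegel, §8 p.47] -/
theorem sliver_Z_bounds {Λ τ θ : ℝ} (hΛ : 0 < Λ) {t : ℕ} (ht : 1 ≤ t)
    (hnY : Real.exp ((θ - τ) * Λ) ≤ (t : ℝ)) (hnθ : (t : ℝ) ≤ Real.exp (θ * Λ)) :
    0 ≤ θ - Real.log (t : ℝ) / Λ ∧ θ - Real.log (t : ℝ) / Λ ≤ τ := by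
  have ht0 : (0 : ℝ) < t := by exact_mod_cast ht
  constructor
  · have : Real.log (t : ℝ) ≤ θ * Λ := by rw [← Real.log_exp (θ * Λ)]; exact Real.log_le_log ht0 hnθ
    have : Real.log (t : ℝ) / Λ ≤ θ := by rw [div_le_iff₀ hΛ]; exact this
    linarith
  · have : (θ - τ) * Λ ≤ Real.log (t : ℝ) := by
      rw [← Real.log_exp ((θ - τ) * Λ)]; exact Real.log_le_log (Real.exp_pos _) hnY
    have : θ - τ ≤ Real.log (t : ℝ) / Λ := by rw [le_div_iff₀ hΛ]; exact this
    linarith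

/-- **Sliver term, case `θ_u = θ_v = θ` (both inner sums crude-small):** `‖M_j(n)[u]·N_j(d,r)[v]‖ ≤ B₁²τ₁²(1 + τ₁Λ)Ξ` for
`dr = n ∈ [e^{(θ−τ₁)Λ}, e^{θΛ}]`, given `‖u(z)‖, ‖v(z)‖ ≤ B₁(θ − z)` on `[0,θ]`. [cite: Zhang2022LandauSiegel, §8 p.47] -/
theorem sliver_term_pair_crude {D : ℕ} (χ : DirichletCharacter ℂ D) (hq : χ.IsQuadratic) (c' : ℝ) (j : ℕ)
    {u v : ℝ → ℂ} {θ B₁ Ξ : ℝ} (huvan : ∀ y : ℝ, θ ≤ y → u y = 0) (hBu : ∀ z ∈ Icc 0 θ, ‖u z‖ ≤ B₁ * (θ - z))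
    (hvvan : ∀ y : ℝ, θ ≤ y → v y = 0) (hBv : ∀ z ∈ Icc 0 θ, ‖v z‖ ≤ B₁ * (θ - z))
    (hB1 : 0 ≤ B₁) (hℓ : 0 < Real.log D) (hθN : Real.exp (θ * Real.log D ^ 9) < Nsupp D) {d r : ℕ}
    (hd : 1 ≤ d) (hr : 1 ≤ r)
    (hnY : Real.exp ((θ - 2 * Real.log D ^ (11 / 10 : ℝ) / Real.log D ^ 9) * Real.log D ^ 9) ≤ ((d * r : ℕ) : ℝ))
    (hnθ : ((d * r : ℕ) : ℝ) ≤ Real.exp (θ * Real.log D ^ 9))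
    (hΞ : ∀ y : ℝ, 1 ≤ y → y ≤ Real.exp (2 * Real.log D ^ (11 / 10 : ℝ) / Real.log D ^ 9 * Real.log D ^ 9) →
      ∑ m ∈ Finset.Ico 1 ⌈y⌉₊, ‖xiZero c' D j m d r‖ / m ≤ Ξ) :
    ‖psiSum c' D χ j u (d * r) * antiSum c' D χ j v d r‖
      ≤ B₁ ^ 2 * (2 * Real.log D ^ (11 / 10 : ℝ) / Real.log D ^ 9) ^ 2
          * (1 + 2 * Real.log D ^ (11 / 10 : ℝ) / Real.log D ^ 9 * Real.log D ^ 9) * Ξ := by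
  set Λ : ℝ := Real.log D ^ 9 with hΛ
  set τ₁ : ℝ := 2 * Real.log D ^ (11 / 10 : ℝ) / Λ with hτ₁
  set t : ℕ := d * r with htdef
  set Z : ℝ := θ - Real.log (t : ℝ) / Λ with hZ
  have hΛ0 : 0 < Λ := by positivity
  have hτ0 : 0 < τ₁ := by
    have : 0 < Real.log D ^ (11 / 10 : ℝ) := Real.rpow_pos_of_pos hℓ _
    positivity
  have ht : 1 ≤ t := Nat.one_le_iff_ne_zero.mpr (Nat.mul_ne_zero (by omega) (by omega))
  obtain ⟨hZ0, hZτ⟩ := sliver_Z_bounds (θ := θ) (τ := τ₁) hΛ0 ht hnY hnθ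
  have hM := norm_psiSum_le_crude χ c' j huvan hBu hB1 hℓ ht hnθ hθN
  have hN := norm_antiSum_le_crude χ hq c' j d r hvvan hBv hB1 hℓ ht hnθ hθN
  have hM' : ‖psiSum c' D χ j u t‖ ≤ B₁ * τ₁ * (1 + τ₁ * Λ) := by
    refine hM.trans ?_
    change B₁ * Z * (1 + Z * Λ) ≤ B₁ * τ₁ * (1 + τ₁ * Λ)
    gcongr
  have hy1 : 1 ≤ Real.exp (Z * Λ) := Real.one_le_exp (mul_nonneg hZ0 hΛ0.le)
  have hyτ : Real.exp (Z * Λ) ≤ Real.exp (τ₁ * Λ) := Real.exp_le_exp.mpr (mul_le_mul_of_nonneg_right hZτ hΛ0.le)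
  have hΞ' := hΞ _ hy1 hyτ
  have hΞ0 : 0 ≤ Ξ := le_trans (Finset.sum_nonneg fun m _ => by positivity) hΞ'
  have hN' : ‖antiSum c' D χ j v d r‖ ≤ B₁ * τ₁ * Ξ := by
    refine hN.trans ?_
    change B₁ * Z * ∑ m ∈ Finset.Ico 1 ⌈Real.exp (Z * Λ)⌉₊, ‖xiZero c' D j m d r‖ / m ≤ B₁ * τ₁ * Ξ
    have h1 : B₁ * Z * ∑ m ∈ Finset.Ico 1 ⌈Real.exp (Z * Λ)⌉₊, ‖xiZero c' D j m d r‖ / m ≤ B₁ * Z * Ξ :=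
      mul_le_mul_of_nonneg_left hΞ' (mul_nonneg hB1 hZ0)
    refine h1.trans ?_
    gcongr
  rw [norm_mul]
  calc ‖psiSum c' D χ j u t‖ * ‖antiSum c' D χ j v d r‖
      ≤ (B₁ * τ₁ * (1 + τ₁ * Λ)) * (B₁ * τ₁ * Ξ) :=
        mul_le_mul hM' hN' (norm_nonneg _) (by positivity)
    _ = B₁ ^ 2 * τ₁ ^ 2 * (1 + τ₁ * Λ) * Ξ := by ring

/-- **Sliver term, case `θ_u < θ_v` (`M_j[u]` crude-small, `N_j[v]` of main-term size):** for `dr = n` in `u`'s sliver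
`[e^{(θ_u−τ₁)Λ}, e^{θ_uΛ}]` and `τ₁ ≤ θ_v − θ_u` (so `v` is in its good range), with `‖u(z)‖ ≤ B₁(θ_u − z)` on `[0,θ_u]` and the
`C²` data of `v` on `[0,θ_v]`: `‖M_j(n)[u]·N_j(d,r)[v]‖ ≤ B₁τ₁(1+τ₁Λ)·Λ⁻¹(‖L′‖K₀ + δN₀)·R(d,r)`.
[cite: Zhang2022LandauSiegel, §8 Lemmas 8.3–8.4, p.47] -/
theorem sliver_term_pair_psiCrude {D : ℕ} [NeZero D] (χ : DirichletCharacter ℂ D) (hq : χ.IsQuadratic) (c' : ℝ)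
    (j : ℕ) (hL : 3 ≤ Real.log D) {u v v' v'' : ℝ → ℂ} {θu θv B₀ B₁ B₂ : ℝ} (hθv1 : θv < 1)
    (huvan : ∀ y : ℝ, θu ≤ y → u y = 0) (hBu : ∀ z ∈ Icc 0 θu, ‖u z‖ ≤ B₁ * (θu - z))
    (hv : ContinuousOn v (Icc 0 θv)) (hv' : ContinuousOn v' (Icc 0 θv)) (hv'' : ContinuousOn v'' (Icc 0 θv))
    (hdv : ∀ y ∈ Ioo 0 θv, HasDerivWithinAt v (v' y) (Ioi y) y)
    (hdv' : ∀ y ∈ Ioo 0 θv, HasDerivWithinAt v' (v'' y) (Ioi y) y) (hvvan : ∀ y : ℝ, θv ≤ y → v y = 0)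
    (hB00 : 0 ≤ B₀) (hB10 : 0 ≤ B₁) (hB20 : 0 ≤ B₂)
    (hB0v : ∀ y ∈ Icc 0 θv, ‖v y‖ ≤ B₀) (hB1v : ∀ y ∈ Icc 0 θv, ‖v' y‖ ≤ B₁) (hB2v : ∀ y ∈ Icc 0 θv, ‖v'' y‖ ≤ B₂)
    (hθuN : Real.exp (θu * Real.log D ^ 9) < Nsupp D) (hθvN : Real.exp (θv * Real.log D ^ 9) < Nsupp D)
    (hgap : 2 * Real.log D ^ (11 / 10 : ℝ) / Real.log D ^ 9 ≤ θv - θu) {d r : ℕ} (hd : 1 ≤ d) (hr : 1 ≤ r)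
    (hnY : Real.exp ((θu - 2 * Real.log D ^ (11 / 10 : ℝ) / Real.log D ^ 9) * Real.log D ^ 9) ≤ ((d * r : ℕ) : ℝ))
    (hnθ : ((d * r : ℕ) : ℝ) ≤ Real.exp (θu * Real.log D ^ 9)) {C₈₄ Ξ : ℝ}
    (h84 : ∀ y : ℝ, bigT D < y → y < bigP D →
      ‖(∑ n ∈ Finset.Ico 1 ⌈y⌉₊, χ (n : ZMod D) * xiZero c' D j n d r / (n : ℂ) *
            ((y / n : ℝ) : ℂ) ^ (-betaMu D 6) * (Real.log (y / n) : ℂ)) -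
          deriv χ.LFunction 1 * PiW χ d r * frakgW c' D j 6 y‖
        ≤ C₈₄ * (Real.log D ^ 6)⁻¹ * (∏ q ∈ (d * r).primeFactors, (1 - (q : ℝ)⁻¹)⁻¹) ^ 2)
    (hΞ : ∀ y : ℝ, 1 ≤ y → y ≤ Real.exp (2 * Real.log D ^ (11 / 10 : ℝ) / Real.log D ^ 9 * Real.log D ^ 9) →
      ∑ n ∈ Finset.Ico 1 ⌈y⌉₊, ‖xiZero c' D j n d r‖ / n ≤ Ξ) :
    ‖psiSum c' D χ j u (d * r) * antiSum c' D χ j v d r‖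
      ≤ (B₁ * (2 * Real.log D ^ (11 / 10 : ℝ) / Real.log D ^ 9)
            * (1 + 2 * Real.log D ^ (11 / 10 : ℝ) / Real.log D ^ 9 * Real.log D ^ 9))
          * ((Real.log D ^ 9)⁻¹ *
              (‖deriv χ.LFunction 1‖ * antiK0 c' D j B₀ B₁ θv
                + deltaN0 c' D j B₀ B₁ B₂ C₈₄ Ξ ‖deriv χ.LFunction 1‖))
          * ((∏ q ∈ (d * r).primeFactors, (1 - (q : ℝ)⁻¹)⁻¹) ^ 2 * (1 + ‖PiW χ d r‖)) := by
  set Λ : ℝ := Real.log D ^ 9 with hΛ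
  set τ₁ : ℝ := 2 * Real.log D ^ (11 / 10 : ℝ) / Λ with hτ₁
  set t : ℕ := d * r with htdef
  set Z : ℝ := θu - Real.log (t : ℝ) / Λ with hZ
  set rel : ℝ := (∏ q ∈ (d * r).primeFactors, (1 - (q : ℝ)⁻¹)⁻¹) ^ 2 with hrel
  have hℓ : 0 < Real.log D := by linarith
  have hΛ0 : 0 < Λ := by positivity
  have hτ0 : 0 < τ₁ := by
    have : 0 < Real.log D ^ (11 / 10 : ℝ) := Real.rpow_pos_of_pos hℓ _
    positivity
  have ht : 1 ≤ t := Nat.one_le_iff_ne_zero.mpr (Nat.mul_ne_zero (by omega) (by omega))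
  obtain ⟨hZ0, hZτ⟩ := sliver_Z_bounds (θ := θu) (τ := τ₁) hΛ0 ht hnY hnθ
  -- ψ-side: crude
  have hM := norm_psiSum_le_crude χ c' j huvan hBu hB10 hℓ ht hnθ hθuN
  have hM' : ‖psiSum c' D χ j u t‖ ≤ B₁ * τ₁ * (1 + τ₁ * Λ) := by
    refine hM.trans ?_
    change B₁ * Z * (1 + Z * Λ) ≤ B₁ * τ₁ * (1 + τ₁ * Λ)
    gcongr
  -- anti side: main term + error (`v` is in its good range: `τ₁ ≤ θ_v − z_t`)
  have hz0 : 0 ≤ Real.log (t : ℝ) / Λ := by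
    have : (1:ℝ) ≤ t := by exact_mod_cast ht
    exact div_nonneg (Real.log_nonneg this) hΛ0.le
  have hZτv : τ₁ ≤ θv - Real.log ((d * r : ℕ) : ℝ) / Λ := by
    change τ₁ ≤ θv - Real.log (t : ℝ) / Λ
    have : Real.log (t : ℝ) / Λ ≤ θu := by linarith
    linarith
  have hzv : Real.log (t : ℝ) / Λ ∈ Icc 0 θv := ⟨hz0, by linarith⟩
  have hNB := anti_main_bound χ hq c' j d r hL hθv1 hv hv' hv'' hdv hdv' hvvan hB00 hB10 hB20 hB0v hB1v hB2v ht
    hZτv hθvN h84 hΞ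
  have hB := norm_antiMain_le χ d r (σ := sigmaJ c' D j) (ν := nuJ c' D j) hB0v hB1v hzv hℓ t
  have hrel1 : 1 ≤ rel := Section8FrontEnd44ReductionRel.one_le_relFac (d * r)
  have hPi0 : 0 ≤ ‖PiW χ d r‖ := norm_nonneg _
  have hPR : ‖PiW χ d r‖ ≤ rel * (1 + ‖PiW χ d r‖) := by nlinarith
  have hK0 : 0 ≤ antiK0 c' D j B₀ B₁ θv := by
    have : 0 ≤ θv := hz0.trans hzv.2
    unfold antiK0; positivity
  have hL'0 : 0 ≤ ‖deriv χ.LFunction 1‖ := norm_nonneg _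
  have hN' : ‖antiSum c' D χ j v d r‖
      ≤ Λ⁻¹ * (‖deriv χ.LFunction 1‖ * antiK0 c' D j B₀ B₁ θv
          + deltaN0 c' D j B₀ B₁ B₂ C₈₄ Ξ ‖deriv χ.LFunction 1‖) * (rel * (1 + ‖PiW χ d r‖)) := by
    set Bm := χ ((d * r : ℕ) : ZMod D) * ((Real.log D ^ 9 : ℝ) : ℂ)⁻¹ * deriv χ.LFunction 1 * PiW χ d r *
      massEx (sigmaJ c' D j) (nuJ c' D j) θv v v' (Real.log ((d * r : ℕ) : ℝ) / Real.log D ^ 9) with hBm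
    have h1 : ‖antiSum c' D χ j v d r‖ ≤ ‖Bm‖ + ‖antiSum c' D χ j v d r - Bm‖ := by
      calc ‖antiSum c' D χ j v d r‖ = ‖Bm + (antiSum c' D χ j v d r - Bm)‖ := by rw [add_sub_cancel]
        _ ≤ ‖Bm‖ + ‖antiSum c' D χ j v d r - Bm‖ := norm_add_le _ _
    refine h1.trans ?_
    have hB' : ‖Bm‖ ≤ Λ⁻¹ * (‖deriv χ.LFunction 1‖ * antiK0 c' D j B₀ B₁ θv) * (rel * (1 + ‖PiW χ d r‖)) := by
      have h2 : ‖Bm‖ ≤ Λ⁻¹ * (‖deriv χ.LFunction 1‖ * ‖PiW χ d r‖ * antiK0 c' D j B₀ B₁ θv) := by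
        rw [hBm]; unfold antiK0; exact hB
      refine h2.trans ?_
      have : Λ⁻¹ * (‖deriv χ.LFunction 1‖ * ‖PiW χ d r‖ * antiK0 c' D j B₀ B₁ θv)
          = Λ⁻¹ * (‖deriv χ.LFunction 1‖ * antiK0 c' D j B₀ B₁ θv) * ‖PiW χ d r‖ := by ring
      rw [this]
      exact mul_le_mul_of_nonneg_left hPR (by positivity)
    have hE' : ‖antiSum c' D χ j v d r - Bm‖
        ≤ Λ⁻¹ * deltaN0 c' D j B₀ B₁ B₂ C₈₄ Ξ ‖deriv χ.LFunction 1‖ * (rel * (1 + ‖PiW χ d r‖)) := by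
      rw [hBm]
      calc _ ≤ _ := hNB
        _ = _ := by rw [hrel]; ring
    calc ‖Bm‖ + ‖antiSum c' D χ j v d r - Bm‖
        ≤ Λ⁻¹ * (‖deriv χ.LFunction 1‖ * antiK0 c' D j B₀ B₁ θv) * (rel * (1 + ‖PiW χ d r‖))
          + Λ⁻¹ * deltaN0 c' D j B₀ B₁ B₂ C₈₄ Ξ ‖deriv χ.LFunction 1‖ * (rel * (1 + ‖PiW χ d r‖)) :=
          add_le_add hB' hE'
      _ = _ := by ring
  have hN0 : 0 ≤ Λ⁻¹ * (‖deriv χ.LFunction 1‖ * antiK0 c' D j B₀ B₁ θv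
      + deltaN0 c' D j B₀ B₁ B₂ C₈₄ Ξ ‖deriv χ.LFunction 1‖) * (rel * (1 + ‖PiW χ d r‖)) :=
    (norm_nonneg _).trans hN'
  rw [norm_mul]
  calc ‖psiSum c' D χ j u t‖ * ‖antiSum c' D χ j v d r‖
      ≤ (B₁ * τ₁ * (1 + τ₁ * Λ)) * (Λ⁻¹ * (‖deriv χ.LFunction 1‖ * antiK0 c' D j B₀ B₁ θv
          + deltaN0 c' D j B₀ B₁ B₂ C₈₄ Ξ ‖deriv χ.LFunction 1‖) * (rel * (1 + ‖PiW χ d r‖))) :=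
        mul_le_mul hM' hN' (norm_nonneg _) (by positivity)
    _ = _ := by rw [hrel]; ring

/-- **Sliver term, case `θ_v < θ_u` (`M_j[u]` of main-term size, `N_j[v]` crude-small):** for `dr = n` in `v`'s sliver
`[e^{(θ_v−τ₁)Λ}, e^{θ_vΛ}]` and `L₁/Λ ≤ θ_u − θ_v` (so `u` is in its good range), with the `C²` data of `u` on `[0,θ_u]` and
`‖v(z)‖ ≤ B₁(θ_v − z)` on `[0,θ_v]`: `‖M_j(n)[u]·N_j(d,r)[v]‖ ≤ Λ⁻¹(‖L′‖J₀ + δM₀)·B₁τ₁Ξ`.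
[cite: Zhang2022LandauSiegel, §8 Lemma 8.2, p.47] -/
theorem sliver_term_pair_antiCrude {D : ℕ} [NeZero D] (χ : DirichletCharacter ℂ D) (hq : χ.IsQuadratic) (c' : ℝ)
    (j : ℕ) (hprim : χ.IsPrimitive) (hL : 3 ≤ Real.log D) (hA : ‖χ.LFunction 1‖ ≤ 1 / Real.log D ^ 2022)
    {u u' u'' v : ℝ → ℂ} {θu θv B₀ B₁ B₂ : ℝ} (hθu1 : θu ≤ 1)
    (hu : ContinuousOn u (Icc 0 θu)) (hu' : ContinuousOn u' (Icc 0 θu)) (hu'' : ContinuousOn u'' (Icc 0 θu))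
    (hdu : ∀ y ∈ Ioo 0 θu, HasDerivWithinAt u (u' y) (Ioi y) y)
    (hdu' : ∀ y ∈ Ioo 0 θu, HasDerivWithinAt u' (u'' y) (Ioi y) y) (huvan : ∀ y : ℝ, θu ≤ y → u y = 0)
    (hB00 : 0 ≤ B₀) (hB10 : 0 ≤ B₁) (hB20 : 0 ≤ B₂)
    (hB0u : ∀ y ∈ Icc 0 θu, ‖u y‖ ≤ B₀) (hB1u : ∀ y ∈ Icc 0 θu, ‖u' y‖ ≤ B₁) (hB2u : ∀ y ∈ Icc 0 θu, ‖u'' y‖ ≤ B₂)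
    (hvvan : ∀ y : ℝ, θv ≤ y → v y = 0) (hBv : ∀ z ∈ Icc 0 θv, ‖v z‖ ≤ B₁ * (θv - z))
    (hθuN : Real.exp (θu * Real.log D ^ 9) < Nsupp D) (hθvN : Real.exp (θv * Real.log D ^ 9) < Nsupp D)
    (hgap : Real.log D ^ (11 / 10 : ℝ) / Real.log D ^ 9 ≤ θu - θv) {d r : ℕ} (hd : 1 ≤ d) (hr : 1 ≤ r)
    (hnY : Real.exp ((θv - 2 * Real.log D ^ (11 / 10 : ℝ) / Real.log D ^ 9) * Real.log D ^ 9) ≤ ((d * r : ℕ) : ℝ))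
    (hnθ : ((d * r : ℕ) : ℝ) ≤ Real.exp (θv * Real.log D ^ 9)) {Ξ : ℝ}
    (hΞ : ∀ y : ℝ, 1 ≤ y → y ≤ Real.exp (2 * Real.log D ^ (11 / 10 : ℝ) / Real.log D ^ 9 * Real.log D ^ 9) →
      ∑ n ∈ Finset.Ico 1 ⌈y⌉₊, ‖xiZero c' D j n d r‖ / n ≤ Ξ) :
    ‖psiSum c' D χ j u (d * r) * antiSum c' D χ j v d r‖
      ≤ ((Real.log D ^ 9)⁻¹ *
            (‖deriv χ.LFunction 1‖ * psiJ0 c' D j B₀ B₁ + deltaM0 c' D j B₀ B₁ B₂ ‖deriv χ.LFunction 1‖))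
          * (B₁ * (2 * Real.log D ^ (11 / 10 : ℝ) / Real.log D ^ 9) * Ξ) := by
  set Λ : ℝ := Real.log D ^ 9 with hΛ
  set τ₁ : ℝ := 2 * Real.log D ^ (11 / 10 : ℝ) / Λ with hτ₁
  set t : ℕ := d * r with htdef
  set Z : ℝ := θv - Real.log (t : ℝ) / Λ with hZ
  have hℓ : 0 < Real.log D := by linarith
  have hΛ0 : 0 < Λ := by positivity
  have hτ0 : 0 < τ₁ := by
    have : 0 < Real.log D ^ (11 / 10 : ℝ) := Real.rpow_pos_of_pos hℓ _
    positivity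
  have ht : 1 ≤ t := Nat.one_le_iff_ne_zero.mpr (Nat.mul_ne_zero (by omega) (by omega))
  obtain ⟨hZ0, hZτ⟩ := sliver_Z_bounds (θ := θv) (τ := τ₁) hΛ0 ht hnY hnθ
  -- anti side: crude
  have hN := norm_antiSum_le_crude χ hq c' j d r hvvan hBv hB10 hℓ ht hnθ hθvN
  have hy1 : 1 ≤ Real.exp (Z * Λ) := Real.one_le_exp (mul_nonneg hZ0 hΛ0.le)
  have hyτ : Real.exp (Z * Λ) ≤ Real.exp (τ₁ * Λ) := Real.exp_le_exp.mpr (mul_le_mul_of_nonneg_right hZτ hΛ0.le)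
  have hΞ' := hΞ _ hy1 hyτ
  have hΞ0 : 0 ≤ Ξ := le_trans (Finset.sum_nonneg fun m _ => by positivity) hΞ'
  have hN' : ‖antiSum c' D χ j v d r‖ ≤ B₁ * τ₁ * Ξ := by
    refine hN.trans ?_
    change B₁ * Z * ∑ m ∈ Finset.Ico 1 ⌈Real.exp (Z * Λ)⌉₊, ‖xiZero c' D j m d r‖ / m ≤ B₁ * τ₁ * Ξ
    have h1 : B₁ * Z * ∑ m ∈ Finset.Ico 1 ⌈Real.exp (Z * Λ)⌉₊, ‖xiZero c' D j m d r‖ / m ≤ B₁ * Z * Ξ :=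
      mul_le_mul_of_nonneg_left hΞ' (mul_nonneg hB10 hZ0)
    refine h1.trans ?_
    gcongr
  -- ψ-side: main term + error (`u` is in its good range: `L₁/Λ ≤ θ_u − z_t`)
  have hz0 : 0 ≤ Real.log (t : ℝ) / Λ := by
    have : (1:ℝ) ≤ t := by exact_mod_cast ht
    exact div_nonneg (Real.log_nonneg this) hΛ0.le
  have hZτu : Real.log D ^ (11 / 10 : ℝ) / Λ ≤ θu - Real.log (t : ℝ) / Λ := by
    have : Real.log (t : ℝ) / Λ ≤ θv := by linarith
    linarith
  have hzu : Real.log (t : ℝ) / Λ ∈ Icc 0 θu := by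
    refine ⟨hz0, ?_⟩
    have : 0 ≤ Real.log D ^ (11 / 10 : ℝ) / Λ := by
      have : 0 < Real.log D ^ (11 / 10 : ℝ) := Real.rpow_pos_of_pos hℓ _
      positivity
    linarith
  have hMB := psi_main_bound χ c' j hprim hL hA hθu1 hu hu' hu'' hdu hdu' huvan hB00 hB10 hB20 hB0u hB1u hB2u ht
    hZτu hθuN
  have hAm := norm_psiMain_le χ c' j hB0u hB1u hzu hℓ t
  have hM' : ‖psiSum c' D χ j u t‖
      ≤ Λ⁻¹ * (‖deriv χ.LFunction 1‖ * psiJ0 c' D j B₀ B₁ + deltaM0 c' D j B₀ B₁ B₂ ‖deriv χ.LFunction 1‖) := by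
    set Am := χ (t : ZMod D) * ((Real.log D ^ 9 : ℝ) : ℂ)⁻¹ * deriv χ.LFunction 1 *
      jetEx (betaJ c' D j * Real.log D ^ 9) u u' (Real.log t / Real.log D ^ 9) with hAm'
    have h1 : ‖psiSum c' D χ j u t‖ ≤ ‖Am‖ + ‖psiSum c' D χ j u t + Am‖ := by
      calc ‖psiSum c' D χ j u t‖ = ‖(psiSum c' D χ j u t + Am) + (-Am)‖ := by rw [add_neg_cancel_right]
        _ ≤ ‖psiSum c' D χ j u t + Am‖ + ‖-Am‖ := norm_add_le _ _
        _ = ‖Am‖ + ‖psiSum c' D χ j u t + Am‖ := by rw [norm_neg, add_comm]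
    refine h1.trans ?_
    calc ‖Am‖ + ‖psiSum c' D χ j u t + Am‖
        ≤ Λ⁻¹ * (‖deriv χ.LFunction 1‖ * psiJ0 c' D j B₀ B₁)
          + Λ⁻¹ * deltaM0 c' D j B₀ B₁ B₂ ‖deriv χ.LFunction 1‖ := add_le_add hAm hMB
      _ = _ := by ring
  have hM0 : 0 ≤ Λ⁻¹ * (‖deriv χ.LFunction 1‖ * psiJ0 c' D j B₀ B₁ + deltaM0 c' D j B₀ B₁ B₂ ‖deriv χ.LFunction 1‖) :=
    (norm_nonneg _).trans hM'
  rw [norm_mul]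
  exact mul_le_mul hM' hN' (norm_nonneg _) hM0

end Literature.NumberTheory.LFunctions.Zhang2022.DipoleRule

end
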